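import Summits.Ventures.PackingBounds.Configurations.LeechCount

/-!
# Cohn–Li kissing configurations (2024), I: odd-sign octad vectors and uniform sign vectors

Framing: lottery ticket; floor = certified bounds/negative ranges. Venture `PackingBounds` (cell
`pub-packcert`, seat `pub-packcert-energy`).

H. Cohn and A. Li (*Improved kissing numbers in seventeen through twenty-one dimensions*,
arXiv:2411.04916, 2024, §2) enlarge the laminated (Leech cross-section) kissing configurations in
dimensions `19, 20, 21` by (a) giving the `±2`-on-an-octad vectors an ODD number of minus signs and
(b) adding the `±1`-sign vectors of Golay codewords (punctured / shortened to the kept coordinates), which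
then have inner product `≤ 12` with every odd octad vector (scale: integer vectors of norm `32`, sign vectors
of norm `n`). This file provides the two new vector families inside `ℤ²⁴` and their inner-product bounds:
`bvecOdd` (norm `32`, pairwise `≤ 16`, `≤ 16` against shape `A`), `svec n` (signs of `cw u` on the
coordinates `< n`), `ip (bvecOdd o v) (svec n u) ≤ 12` when the octad lies in the kept coordinates
(self-orthogonality of the Golay code + odd parity), `ip (avec k l a b) (svec n u) ≤ 8`.
Counting and the transfer to `ℝ²¹, ℝ²⁰, ℝ¹⁹` are in `CohnLiCount.lean` / `CohnLi.lean`.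

## References
* H. Cohn, A. Li, *Improved kissing numbers in seventeen through twenty-one dimensions*, arXiv:2411.04916 (2024), §2.
* J. H. Conway, N. J. A. Sloane, *Sphere Packings, Lattices and Groups*, Ch. 6. [`ConwaySloane1999`]
-/

namespace Summit.Ventures.PackingBounds.Config.Leech

open Finset Golay

/-! ### Odd sign patterns -/

/-- The `8` sign bits of the ODD pattern `v < 128`: bits `0..6` of `v` and the complemented parity bit. -/
def bbitOdd (v : ℕ) (r : Fin 8) : Bool := if r.val < 7 then v.testBit r.val else !decide (cnt7 v % 2 = 1)

/-- An odd pattern has an odd number of minus signs. -/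
theorem odd_card_bbitOdd (v : ℕ) : Odd (univ.filter fun r : Fin 8 => bbitOdd v r = true).card := by
  rw [Finset.card_filter, Fin.sum_univ_castSucc]
  have h7 : ∑ t : Fin 7, (if bbitOdd v t.castSucc = true then 1 else 0) = cnt7 v := by
    rw [cnt7, Finset.card_filter]
    refine Finset.sum_congr rfl fun t _ => ?_
    simp [bbitOdd, t.isLt]
  rw [h7]
  have hl : bbitOdd v (Fin.last 7) = !decide (cnt7 v % 2 = 1) := by simp [bbitOdd]
  rw [hl]
  by_cases h : cnt7 v % 2 = 1
  · simp only [h, decide_true, Bool.not_true, Bool.false_eq_true, if_false, add_zero]; exact ⟨cnt7 v / 2, by omega⟩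
  · simp only [h, decide_false, Bool.not_false, if_true]; exact ⟨cnt7 v / 2, by omega⟩

/-- Odd patterns `v ≠ v' < 128` differ in some sign bit. -/
theorem bbitOdd_ne_of_ne {v v' : ℕ} (hv : v < 128) (hv' : v' < 128) (h : v ≠ v') : ∃ r, bbitOdd v r ≠ bbitOdd v' r := by
  by_contra hall
  simp only [ne_eq, not_exists, Decidable.not_not] at hall
  apply h
  apply Nat.eq_of_testBit_eq
  intro t
  by_cases ht : t < 7
  · have := hall ⟨t, by omega⟩
    simpa [bbitOdd, ht] using this
  · have h128 : 2 ^ 7 ≤ 2 ^ t := Nat.pow_le_pow_right (by norm_num) (by omega)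
    rw [Nat.testBit_eq_false_of_lt (lt_of_lt_of_le hv h128),
      Nat.testBit_eq_false_of_lt (lt_of_lt_of_le hv' h128)]

/-- Parity of a pointwise `XOR` of an odd and an even indicator count is odd. -/
theorem odd_card_filter_xor {ι : Type*} [Fintype ι] {f g : ι → Bool}
    (hf : Odd (univ.filter fun i => f i = true).card) (hg : Even (univ.filter fun i => g i = true).card) :
    Odd (univ.filter fun i => (f i ^^ g i) = true).card := by
  have h := card_filter_xor_add f g
  obtain ⟨a, ha⟩ := hf; obtain ⟨b, hb⟩ := hg
  exact ⟨a + b - (univ.filter fun i => (f i && g i) = true).card, by omega⟩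

/-- Parity of a pointwise `XOR` of two odd indicator counts is even. -/
theorem even_card_filter_xor_of_odd {ι : Type*} [Fintype ι] {f g : ι → Bool}
    (hf : Odd (univ.filter fun i => f i = true).card) (hg : Odd (univ.filter fun i => g i = true).card) :
    Even (univ.filter fun i => (f i ^^ g i) = true).card := by
  have h := card_filter_xor_add f g
  obtain ⟨a, ha⟩ := hf; obtain ⟨b, hb⟩ := hg
  exact ⟨a + b + 1 - (univ.filter fun i => (f i && g i) = true).card, by omega⟩

/-! ### Odd shape-`B` vectors -/

/-- Odd shape-`B` vector on the octad `o`: `±2` on the octad with an ODD number of minus signs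
(Cohn–Li's modification). -/
def bvecOdd (o : Fin 759) (v : ℕ) : Fin 24 → ℤ :=
  fun j => if h : j ∈ osupp o then 2 * sgn (bbitOdd v ((opos o).symm ⟨j, h⟩)) else 0

/-- Values of an odd shape-`B` vector on its octad. -/
theorem bvecOdd_apply_opos (o : Fin 759) (v : ℕ) (r : Fin 8) :
    bvecOdd o v ((opos o r : osupp o) : Fin 24) = 2 * sgn (bbitOdd v r) := by
  simp only [bvecOdd, dif_pos (opos o r).2, Subtype.coe_eta, OrderIso.symm_apply_apply]

/-- An odd shape-`B` vector vanishes off its octad. -/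
theorem bvecOdd_eq_zero {o : Fin 759} {v : ℕ} {j : Fin 24} (h : j ∉ osupp o) : bvecOdd o v j = 0 := by
  simp [bvecOdd, h]

/-- Coordinates of an odd shape-`B` vector are `0` off the octad, `±2` on it. -/
theorem bvecOdd_apply_cases (o : Fin 759) (v : ℕ) (j : Fin 24) :
    (j ∉ osupp o ∧ bvecOdd o v j = 0) ∨ (j ∈ osupp o ∧ (bvecOdd o v j = 2 ∨ bvecOdd o v j = -2)) := by
  by_cases h : j ∈ osupp o
  · right; refine ⟨h, ?_⟩
    simp only [bvecOdd, dif_pos h]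
    rcases sgn_cases (bbitOdd v ((opos o).symm ⟨j, h⟩)) with h1 | h1 <;> rw [h1] <;> simp
  · left; exact ⟨h, bvecOdd_eq_zero h⟩

/-- Testing a vector against an odd shape-`B` vector. -/
theorem ip_bvecOdd (x : Fin 24 → ℤ) (o : Fin 759) (v : ℕ) :
    ip x (bvecOdd o v) = ∑ r : Fin 8, x (opos o r) * (2 * sgn (bbitOdd v r)) := by
  unfold ip
  rw [← Finset.sum_subset (Finset.subset_univ (osupp o)) (fun j _ hj => by rw [bvecOdd_eq_zero hj, mul_zero]),
    sum_osupp]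
  exact Finset.sum_congr rfl fun r _ => by rw [bvecOdd_apply_opos]

/-- Norm of an odd shape-`B` vector. -/
theorem ip_bvecOdd_self (o : Fin 759) (v : ℕ) : ip (bvecOdd o v) (bvecOdd o v) = 32 := by
  rw [ip_bvecOdd]
  simp only [bvecOdd_apply_opos]
  have : ∀ r : Fin 8, 2 * sgn (bbitOdd v r) * (2 * sgn (bbitOdd v r)) = 4 := by
    intro r; rcases sgn_cases (bbitOdd v r) with h | h <;> rw [h] <;> norm_num
  simp [this]

/-- Two distinct odd shape-`B` vectors on the same octad: inner product `≤ 16`. -/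
theorem ip_bvecOdd_same_le (o : Fin 759) {v v' : ℕ} (hv : v < 128) (hv' : v' < 128)
    (hne : bvecOdd o v ≠ bvecOdd o v') : ip (bvecOdd o v) (bvecOdd o v') ≤ 16 := by
  have hvv : v ≠ v' := fun h => hne (by rw [h])
  rw [ip_bvecOdd]
  simp only [bvecOdd_apply_opos]
  have : ∀ r : Fin 8, 2 * sgn (bbitOdd v r) * (2 * sgn (bbitOdd v' r)) = 4 * sgn (bbitOdd v r ^^ bbitOdd v' r) := by
    intro r; rw [← sgn_mul_sgn]; ring
  simp only [this, ← Finset.mul_sum, sum_sgn, Fintype.card_fin]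
  have hev := even_card_filter_xor_of_odd (odd_card_bbitOdd v) (odd_card_bbitOdd v')
  obtain ⟨r, hr⟩ := bbitOdd_ne_of_ne hv hv' hvv
  have hpos : 0 < (univ.filter fun r : Fin 8 => (bbitOdd v r ^^ bbitOdd v' r) = true).card := by
    apply Finset.card_pos.mpr
    refine ⟨r, Finset.mem_filter.mpr ⟨Finset.mem_univ _, ?_⟩⟩
    cases h1 : bbitOdd v r <;> cases h2 : bbitOdd v' r <;> simp_all
  obtain ⟨m, hm⟩ := hev
  push_cast
  omega

/-- Two odd shape-`B` vectors on distinct octads: inner product `≤ 16`. -/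
theorem ip_bvecOdd_ne_le {o o' : Fin 759} (hoo : o ≠ o') (v v' : ℕ) :
    ip (bvecOdd o v) (bvecOdd o' v') ≤ 16 := by
  rw [ip_bvecOdd]
  have hle : ∀ r : Fin 8, bvecOdd o v (opos o' r) * (2 * sgn (bbitOdd v' r)) ≤
      4 * (if ((opos o' r : osupp o') : Fin 24) ∈ osupp o then 1 else 0) := by
    intro r
    rcases bvecOdd_apply_cases o v (opos o' r) with ⟨h0, h1⟩ | ⟨h0, h1 | h1⟩ <;>
      rcases sgn_cases (bbitOdd v' r) with h2 | h2 <;> simp [h0, h1, h2]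
  refine (Finset.sum_le_sum fun r _ => hle r).trans ?_
  rw [← Finset.mul_sum, ← Finset.natCast_card_filter, card_filter_opos o' (· ∈ osupp o),
    Finset.filter_mem_eq_inter, Finset.inter_comm]
  have := card_osupp_inter_le hoo
  omega

/-- A shape-`A` vector against an odd shape-`B` vector: inner product `≤ 16`. -/
theorem ip_avec_bvecOdd_le {k l : Fin 24} (hkl : k < l) (a b : Bool) (o : Fin 759) (v : ℕ) :
    ip (avec k l a b) (bvecOdd o v) ≤ 16 := by
  rw [ip_comm, ip_avec]
  have _ := hkl
  rcases sgn_cases a with ha | ha <;> rcases sgn_cases b with hb | hb <;> rw [ha, hb] <;>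
    rcases bvecOdd_apply_cases o v k with ⟨_, hk1⟩ | ⟨_, hk1 | hk1⟩ <;>
    rcases bvecOdd_apply_cases o v l with ⟨_, hl1⟩ | ⟨_, hl1 | hl1⟩ <;> rw [hk1, hl1] <;> norm_num

/-- Support of an odd shape-`B` vector. -/
theorem bvecOdd_ne_zero_iff (o : Fin 759) (v : ℕ) (j : Fin 24) : bvecOdd o v j ≠ 0 ↔ j ∈ osupp o := by
  rcases bvecOdd_apply_cases o v j with ⟨h0, h1⟩ | ⟨h0, h1 | h1⟩ <;> simp [h0, h1]

/-- The odd shape-`B` parametrisation is injective. -/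
theorem bvecOdd_inj {o o' : Fin 759} {v v' : ℕ} (hv : v < 128) (hv' : v' < 128)
    (h : bvecOdd o v = bvecOdd o' v') : o = o' ∧ v = v' := by
  have hoo : o = o' := by
    apply osupp_injective
    ext j
    rw [← bvecOdd_ne_zero_iff o v j, ← bvecOdd_ne_zero_iff o' v' j, h]
  subst hoo
  refine ⟨rfl, ?_⟩
  by_contra hvv
  obtain ⟨r, hr⟩ := bbitOdd_ne_of_ne hv hv' hvv
  apply hr
  have e := congrFun h (opos o r)
  rw [bvecOdd_apply_opos, bvecOdd_apply_opos] at e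
  exact sgn_injective (by omega)

/-! ### Uniform sign vectors on the kept coordinates `< n` -/

/-- The sign vector of the codeword `cw u` on the coordinates `< n` (zero beyond). -/
def svec (n : ℕ) (u : ℕ) : Fin 24 → ℤ := fun j => if j.val < n then sgn ((cw u).testBit j.val) else 0

/-- Restricted weight: number of coordinates `< n` in the support of a mask. -/
def wtK (n : ℕ) (m : ℕ) : ℕ := (univ.filter fun j : Fin 24 => j.val < n ∧ m.testBit j.val = true).card

/-- There are `n` coordinates `< n` (`n ≤ 24`). -/
theorem card_filter_val_lt {n : ℕ} (hn : n ≤ 24) : (univ.filter fun j : Fin 24 => j.val < n).card = n := by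
  have h : (univ.filter fun j : Fin 24 => j.val < n) =
      (range n).attachFin (fun m hm => lt_of_lt_of_le (mem_range.mp hm) hn) := by
    ext j; simp [Finset.mem_attachFin]
  rw [h, Finset.card_attachFin, card_range]

/-- Inner product of two sign vectors in terms of the restricted weight of `cw (u ⊕ u')`. -/
theorem ip_svec_svec (n : ℕ) (u u' : ℕ) :
    ip (svec n u) (svec n u') =
      ((univ.filter fun j : Fin 24 => j.val < n).card : ℤ) - 2 * (wtK n (cw (u ^^^ u')) : ℤ) := by
  unfold ip wtK
  have hterm : ∀ j : Fin 24, svec n u j * svec n u' j =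
      (if j.val < n then (1 : ℤ) else 0) - 2 * (if j.val < n ∧ (cw (u ^^^ u')).testBit j.val = true then 1 else 0) := by
    intro j
    simp only [svec]
    by_cases hj : j.val < n
    · simp only [hj, if_true, true_and]
      rw [sgn_mul_sgn, cw_xor, Nat.testBit_xor, sgn_eq]
    · simp [hj]
  simp only [hterm, Finset.sum_sub_distrib, ← Finset.mul_sum, Finset.sum_boole]

/-- Norm of a sign vector: the number of kept coordinates. -/
theorem ip_svec_self {n : ℕ} (hn : n ≤ 24) (u : ℕ) : ip (svec n u) (svec n u) = n := by
  rw [ip_svec_svec, Nat.xor_self, cw_zero]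
  have h0 : wtK n 0 = 0 := by simp [wtK]
  rw [h0, card_filter_val_lt hn]; simp

/-- Coordinates of a sign vector are `±1` on the kept coordinates and `0` beyond. -/
theorem svec_apply_cases (n u : ℕ) (j : Fin 24) :
    (j.val < n ∧ (svec n u j = 1 ∨ svec n u j = -1)) ∨ (¬ j.val < n ∧ svec n u j = 0) := by
  unfold svec
  by_cases hj : j.val < n
  · left; refine ⟨hj, ?_⟩
    rcases sgn_cases ((cw u).testBit j.val) with h | h <;> simp [hj, h]
  · right; simp [hj]

/-- A shape-`A` vector against a sign vector: inner product `≤ 8`. -/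
theorem ip_avec_svec_le {k l : Fin 24} (hkl : k < l) (a b : Bool) (n u : ℕ) :
    ip (avec k l a b) (svec n u) ≤ 8 := by
  rw [ip_comm, ip_avec]
  have _ := hkl
  rcases sgn_cases a with ha | ha <;> rcases sgn_cases b with hb | hb <;> rw [ha, hb] <;>
    rcases svec_apply_cases n u k with ⟨_, hk1 | hk1⟩ | ⟨_, hk1⟩ <;>
    rcases svec_apply_cases n u l with ⟨_, hl1 | hl1⟩ | ⟨_, hl1⟩ <;> rw [hk1, hl1] <;> norm_num

/-- **An odd octad vector against a sign vector: inner product `≤ 12`** when the octad lies in the kept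
coordinates (the Golay codeword meets the octad evenly, the octad vector has an odd number of minus signs, so
at least one sign disagrees: Cohn–Li 2024, §2). -/
theorem ip_bvecOdd_svec_le (o : Fin 759) (v : ℕ) {n u : ℕ} (hO : ∀ j ∈ osupp o, j.val < n) (hu : u < 4096) :
    ip (bvecOdd o v) (svec n u) ≤ 12 := by
  rw [ip_comm, ip_bvecOdd]
  let q : Fin 8 → Bool := fun r => (cw u).testBit ((opos o r : osupp o) : Fin 24).val ^^ bbitOdd v r
  have hterm : ∀ r : Fin 8, svec n u (opos o r) * (2 * sgn (bbitOdd v r)) = 2 * sgn (q r) := by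
    intro r
    have hr : ((opos o r : osupp o) : Fin 24).val < n := hO _ (opos o r).2
    simp only [svec, hr, if_true, q, ← sgn_mul_sgn]
    ring
  simp only [hterm, ← Finset.mul_sum, sum_sgn, Fintype.card_fin]
  have hf : Even (univ.filter fun r : Fin 8 =>
      (cw u).testBit ((opos o r : osupp o) : Fin 24).val = true).card := by
    rw [card_filter_opos o (fun j : Fin 24 => (cw u).testBit j.val = true)]
    have h2 := even_card_supp_inter_osupp hu o
    have h3 : supp (cw u) ∩ osupp o = (osupp o).filter fun j => (cw u).testBit j.val = true := by
      ext j; simp [supp, and_comm]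
    rwa [h3] at h2
  have hodd : Odd (univ.filter fun r : Fin 8 => q r = true).card := by
    have := odd_card_filter_xor (odd_card_bbitOdd v) hf
    -- `q r = bit ^^ bbitOdd`; the lemma gives `bbitOdd ^^ bit`: same set
    have hset : (univ.filter fun r : Fin 8 => (bbitOdd v r ^^ (cw u).testBit ((opos o r : osupp o) : Fin 24).val) = true) =
        (univ.filter fun r : Fin 8 => q r = true) := by
      congr 1; ext r; simp only [q, Bool.xor_comm]
    rwa [hset] at this
  obtain ⟨m, hm⟩ := hodd
  push_cast
  omega

/-- **Two sign vectors**: if the codeword `cw (u ⊕ u')` has at least `w` ones among the kept coordinates then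
`ip ≤ n - 2w`. -/
theorem ip_svec_svec_le {n : ℕ} (hn : n ≤ 24) {u u' : ℕ} {w : ℕ} (hw : w ≤ wtK n (cw (u ^^^ u'))) :
    ip (svec n u) (svec n u') ≤ (n : ℤ) - 2 * w := by
  rw [ip_svec_svec, card_filter_val_lt hn]
  omega

/-- The restricted weight is at least the full weight minus the number of coordinates `≥ n` in the support. -/
theorem wtK_add_card_ge (n m : ℕ) :
    wt m ≤ wtK n m + (univ.filter fun j : Fin 24 => ¬ j.val < n ∧ m.testBit j.val = true).card := by
  unfold wt wtK supp
  rw [← Finset.card_union_of_disjoint ?_]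
  · apply Finset.card_le_card
    intro j hj
    simp only [Finset.mem_filter, Finset.mem_univ, true_and] at hj
    simp only [Finset.mem_union, Finset.mem_filter, Finset.mem_univ, true_and]
    by_cases h : j.val < n
    · exact Or.inl ⟨h, hj⟩
    · exact Or.inr ⟨h, hj⟩
  · rw [Finset.disjoint_filter]; intro j _ h1 h2; exact h2.1 h1.1

end Summit.Ventures.PackingBounds.Config.Leech
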